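import Literature.Geometry.Lorentzian.LevelCurveGeodesicCurvature
import Literature.Geometry.Lorentzian.HypersurfaceHessian
import HarnessLib

/-!
# Schoen–Yau 1979, (2.27): the geodesic curvature of a level curve on an immersed surface in
# terms of the ambient Hessian and the second fundamental form

Schoen–Yau, Comm. Math. Phys. 65 (1979), §2, p. 58: for the boundary curve `∂D_σ = S ∩ {r' = σ}`
of the exhaustion of the minimal surface `S ⊂ (N, ds²)`, with `e₁` the unit tangent of `∂D_σ`,
`e₂` the inner normal in `S`, `e₃ = ν` the normal of `S`, *"The geodesic curvature `k` is given
by `k = ⟨D_{e₁}e₁, e₂⟩`. Since `r' = σ` on `∂D_σ`, we have `⟨e₁, Dr'⟩ = 0` on `∂D_σ`.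
Differentiating this with respect to `e₁` gives `⟨D_{e₁}e₁, Dr'⟩ = −Hess r'(e₁, e₁)` … Since
`D_{e₁}e₁ = k e₂ − h₁₁ ν`, this gives (2.27) `k⟨e₂, Dr'⟩ = h₁₁⟨ν, Dr'⟩ − Hess_N r'(e₁, e₁)`."*

This file proves (2.27) for an arbitrary spacelike immersed hypersurface `F : (S, F^*g) → (X, g)`
with unit normal `ν` of sign `ε`, an ambient function `φ ∈ C²(X)` and a level curve `γ` of
`φ ∘ F` in `S` (`val_covariantDerivAlong_velocity_grad_comp_of_level`):

  `⟨D^S_t γ', grad_S(φ ∘ F)⟩ = (dφ(ν)/ε) K(γ', γ') − Hess_g φ(dF γ', dF γ')`,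

the left-hand side being `k ⟨e₂, Dr'⟩` (`D^S_t γ' = k e₂` for a unit-speed `γ`, and
`⟨e₂, grad_S(φ∘F)⟩ = ⟨e₂, Dr'⟩` since `e₂` is tangent to `S`), the right-hand side
`h₁₁⟨ν, Dr'⟩ − Hess_N r'(e₁, e₁)`. It is the intrinsic identity
`⟨D_t γ', grad f⟩ = −Hess_{F^*g} f(γ', γ')` for level curves (`LevelCurveGeodesicCurvature.lean`)
combined with the restriction formula `Hess_{F^*g}(φ ∘ F)(v, w) = Hess_g φ(dF v, dF w) −
(dφ(ν)/ε) K(v, w)` (`HypersurfaceHessian.lean`, O'Neill 1983, Ch. 4, Lemma 4.3–4.4). Everything is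
proved; no definitions, no named facts.

## References

* R. Schoen, S.-T. Yau, *On the proof of the positive mass conjecture in general relativity*,
  Comm. Math. Phys. 65 (1979) 45–76, §2, p. 58, (2.27). [SchoenYauPMT1979]
* B. O'Neill, *Semi-Riemannian geometry with applications to relativity*, Academic Press 1983,
  Ch. 3, Lemma 3.49; Ch. 4, Lemma 4.3–4.4. [ONeill1983]
-/

noncomputable section

open Bundle Set Function Filter Manifold FiberBundle Module
open scoped Manifold ContDiff Topology

namespace Literature.Geometry.Lorentzian

namespace PseudoRiemannianMetric

variable {E : Type*} [NormedAddCommGroup E] [NormedSpace ℝ E] {H : Type*} [TopologicalSpace H]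
  {I : ModelWithCorners ℝ E H} {M : Type*} [TopologicalSpace M] [ChartedSpace H M]
  [IsManifold I ∞ M] [FiniteDimensional ℝ E] [CompleteSpace E] [I.Boundaryless]
  (g : PseudoRiemannianMetric I ∞ E (TangentSpace I : M → Type _)) [g.HasLeviCivita]
  {E' : Type*} [NormedAddCommGroup E'] [NormedSpace ℝ E'] {H' : Type*} [TopologicalSpace H']
  {I' : ModelWithCorners ℝ E' H'} {N : Type*} [TopologicalSpace N] [ChartedSpace H' N]
  [IsManifold I' ∞ N] [FiniteDimensional ℝ E'] [CompleteSpace E'] [I'.Boundaryless] {f : N → M}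
  (hpb : PseudoRiemannianMetric.contMDiff_pullbackBilin I M I' N ∞)
  (hfi : g.IsSpacelikeImmersion I' f) {ν : NormalField I f} {ε : ℝ}

/-- **Schoen–Yau 1979, (2.27).** Let `f : (N, f^*g) → (M, g)` be a spacelike immersion of a
hypersurface (`dim M = dim N + 1`) with unit normal field `ν` of sign `ε ≠ 0` (smooth lift) and
second fundamental form `K`, `φ ∈ C²(M)`, and `γ` a level curve of `φ ∘ f` in `N` (`φ ∘ f ∘ γ`
constant near `t₀`, `γ` differentiable near `t₀` with tangent lift differentiable at `t₀`). Then,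
with `D_t` the covariant derivative of `(N, f^*g)` along `γ` and `grad (φ ∘ f)` the `f^*g`-gradient,

  `⟨D_t γ'(t₀), grad(φ ∘ f)⟩_{f^*g} = (dφ(ν)/ε) K(γ' t₀, γ' t₀) − Hess_g φ(df γ' t₀, df γ' t₀)`

(printed: `k⟨e₂, Dr'⟩ = h₁₁⟨ν, Dr'⟩ − Hess_N r'(e₁, e₁)` for `φ = r'`, `e₁ = γ'` of unit speed,
`D_{e₁}e₁ = k e₂ − h₁₁ν`). Proof: `⟨D_t γ', grad(φ∘f)⟩ = −Hess_{f^*g}(φ ∘ f)(γ', γ')`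
(`val_covariantDerivAlong_velocity_grad_of_level`, differentiating `d(φ∘f)(γ') ≡ 0`) and
`Hess_{f^*g}(φ ∘ f)(γ', γ') = Hess_g φ(df γ', df γ') − (dφ(ν)/ε) K(γ', γ')` (`hessian_comp_apply`).
[cite: SchoenYauPMT1979, §2 (2.27) (p. 58)] -/
theorem val_covariantDerivAlong_velocity_grad_comp_of_level
    (hν : ContMDiff I' I.tangent ∞ (fun x ↦ (TotalSpace.mk' E (f x) (ν x) : TangentBundle I M)))
    (hun : g.IsUnitNormal I' f ν ε) (hε : ε ≠ 0)
    (hdim : Module.finrank ℝ E = Module.finrank ℝ E' + 1)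
    {φ : M → ℝ} (hφ : CMDiff 2 φ) {γ : ℝ → N} {t₀ : ℝ}
    (hγ : ∀ᶠ t in 𝓝 t₀, MDifferentiableAt 𝓘(ℝ, ℝ) I' γ t)
    (hγ2 : MDifferentiableAt 𝓘(ℝ, ℝ) I'.tangent
      (fun t ↦ (TotalSpace.mk' E' (γ t) (velocity I' γ t) : TangentBundle I' N)) t₀)
    (hlev : ∀ᶠ t in 𝓝 t₀, φ (f (γ t)) = φ (f (γ t₀))) :
    haveI := (g.inducedMetric f hpb hfi).hasLeviCivita
    (g.inducedMetric f hpb hfi).val (γ t₀)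
        (covariantDerivAlong (g.inducedMetric f hpb hfi).leviCivita γ
          (fun t ↦ velocity I' γ t) t₀)
        ((g.inducedMetric f hpb hfi).sharp (γ t₀)
          (mvfderiv I' (fun y ↦ φ (f y)) (γ t₀)).toLinearMap) =
      mvfderiv I φ (f (γ t₀)) (ν (γ t₀)) / ε *
          g.secondFundamentalForm I' f ν (γ t₀) (velocity I' γ t₀) (velocity I' γ t₀) -
        g.hessian φ (f (γ t₀)) (mfderiv I' I f (γ t₀) (velocity I' γ t₀))
          (mfderiv I' I f (γ t₀) (velocity I' γ t₀)) := by
  haveI := (g.inducedMetric f hpb hfi).hasLeviCivita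
  have h2le : (2 : ℕ∞ω) ≤ ∞ := WithTop.coe_le_coe.mpr le_top
  have hφf : CMDiffAt 2 (fun y ↦ φ (f y)) (γ t₀) :=
    ((hφ.comp (hfi.contMDiff_self.of_le h2le)) (γ t₀))
  rw [(g.inducedMetric f hpb hfi).val_covariantDerivAlong_velocity_grad_of_level hφf hγ hγ2 hlev,
    g.hessian_comp_apply hpb hfi hν hun hε hdim hφ (γ t₀) (velocity I' γ t₀) (velocity I' γ t₀)]
  ring

end PseudoRiemannianMetric

end Literature.Geometry.Lorentzian

end
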